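import Literature.NumberTheory.Automorphic.SmoothInductionSphericalLine
import Mathlib.GroupTheory.DoubleCoset
import HarnessLib

/-!
# The `K`-fixed vectors of an induced representation along a double-coset decomposition `G = ⨆ᵢ H gᵢ K`:
# `(Ind_H^G σ)^K ≅ Πᵢ W^{σ(H ∩ gᵢ K gᵢ⁻¹)}` (Mackey's formula for fixed vectors)

Topic `NumberTheory/Automorphic`; namespace `Representation` (dot-extensions of the tree's ★ `SmoothInduction`, as in ★
`SmoothInductionSphericalLine`, whose one-coset case `G = H · K` this file generalises).  PROOF FILE: theorems only (no definition,
no named fact, no instance, no notation, no `sorry`).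

SETTING: a topological group `G`, subgroups `H, K ≤ G` with `K` OPEN, a representation `σ` of `H` on `W`, the smooth induction
★ `smoothIndRep H σ` on ★ `SmoothInd H σ` (functions `f : G → W` with `f (h g) = σ h (f g)`, right translation), and a family
`g : ι → G` of DOUBLE-COSET REPRESENTATIVES: `hcover : ∀ y, ∃ i h κ, y = h · g i · κ` (the double cosets `H gᵢ K` cover `G`) and
`hdisj : (∃ h κ, g j = h · g i · κ) → i = j` (distinct indices give distinct double cosets) — equivalently `i ↦ H gᵢ K` is a
bijection `ι → H\G/K` (§3, Mathlib's `DoubleCoset.Quotient`).  The subgroup `H ∩ x K x⁻¹` of `H` is spelled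
`(K.map (MulAut.conj x).toMonoidHom).subgroupOf H` (membership: `x⁻¹ h x ∈ K`, `mem_subgroupOf_map_conj_iff`).

* §0 `mem_subgroupOf_map_conj_iff`, `subgroupOf_map_conj_one` (at `x = 1` it is `H ∩ K`).
* §1 (M1) `toFun_mem_fixedPoints_subgroupOf_map_conj`: `f ∈ (Ind σ)^K ⇒ f(x) ∈ W^{σ(H ∩ xKx⁻¹)}`; `toFun_eq_of_mem_fixedPoints_of_eq_mul`:
  `f(h x κ) = σ h f(x)`; (M2) `eq_of_forall_toFun_apply_eq`: a `K`-fixed vector is determined by its values at the `gᵢ` (needs `hcover`);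
  `apply_eq_apply_of_mul_mul_eq` (well-definedness of `h gᵢ κ ↦ σ h wᵢ`); (M3) `exists_mem_fixedPoints_forall_toFun_eq`: every family
  `wᵢ ∈ W^{σ(H ∩ gᵢKgᵢ⁻¹)}` is the family of values of a (unique) `K`-fixed vector (needs `hdisj` and `K` open: the vector is smooth
  because the open `K` fixes it).
* §2 (M4) `nonempty_fixedPoints_linearEquiv_pi`: `(Ind_H^G σ)^K ≃ₗ[k] Πᵢ W^{σ(H ∩ gᵢKgᵢ⁻¹)}` through `f ↦ (f gᵢ)ᵢ`; over a field with `W`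
  finite-dimensional and `ι` finite: `finrank_fixedPoints_smoothIndRep_le_sum` (from `hcover` alone), `finrank_fixedPoints_smoothIndRep_eq_sum`;
  for a CHARACTER (`W` a line): `finrank_fixedPoints_line_eq_ite` (`W^{σ(S)}` is `W` or `0`), `finrank_fixedPoints_smoothIndRep_eq_card_filter`
  (`dim (Ind σ)^K = #{i | σ trivial on H ∩ gᵢKgᵢ⁻¹}` — MACKEY'S COUNT) and `finrank_fixedPoints_smoothIndRep_eq_card` (all of them trivial:
  `dim = |ι|`, e.g. `dim (i_B χ)^I = |W|` for an unramified `χ` along a Bruhat–Iwahori decomposition `G = ⨆_w B w I`).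
* §3 the same indexed by Mathlib's double-coset space `H\G/K` with the representatives `q.out`:
  `exists_eq_mul_out_mul`, `eq_of_out_eq_mul_out_mul`, `nonempty_fixedPoints_linearEquiv_pi_doubleCoset`,
  `finrank_fixedPoints_smoothIndRep_eq_sum_doubleCoset`; and the dictionary `cover`∕`disj` ⟸ surjectivity∕injectivity of `i ↦ H gᵢ K`
  (`exists_eq_mul_mul_of_surjective_mk`, `eq_of_injective_mk`).

These are the standard «Mackey» computations of `K`-fixed vectors in induced representations (Bernstein–Zelevinsky 1976 §2.21–2.25 and
1977 §2.3; Cartier's Corvallis survey §III.3: «a function in `I(σ)` is determined by its restriction to a set of representatives of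
`P\G/K`»; Casselman's notes §3 / Borel 1976 §3–4 for the Iwahori case `dim I(χ)^B = |W|`).

## References
* [BernsteinZelevinsky1976] I. N. Bernstein, A. V. Zelevinsky, *Representations of the group GL(n,F) where F is a non-archimedean local
  field*, Russian Math. Surveys 31:3 (1976), §2.21–2.25.
* [BernsteinZelevinsky1977] I. N. Bernstein, A. V. Zelevinsky, *Induced representations of reductive 𝔭-adic groups I*, Ann. Sci. ÉNS 10
  (1977), §2.3.
* [CartierCorvallis1979] P. Cartier, *Representations of 𝔭-adic groups: a survey*, PSPM 33.1 (1979), §III.3–§IV.1.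
* [Casselman1995] W. Casselman, *Introduction to the theory of admissible representations of 𝔭-adic reductive groups* (notes, 1995), §3.
* [Borel1976] A. Borel, *Admissible representations of a semi-simple group over a local field with vectors fixed under an Iwahori
  subgroup*, Invent. Math. 35 (1976), §3–§4.
-/

set_option autoImplicit false

noncomputable section

open Topology

namespace Representation

variable {k G W : Type*} [CommRing k] [Group G] [TopologicalSpace G] [SeparatelyContinuousMul G] [AddCommGroup W] [Module k W]
  (H K : Subgroup G) (σ : Representation k H W)

/-! ## §0 The subgroups `H ∩ x K x⁻¹` of `H` -/

omit [TopologicalSpace G] [SeparatelyContinuousMul G] in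
/-- Membership in `H ∩ x K x⁻¹ ≤ H`, spelled `(K.map (MulAut.conj x).toMonoidHom).subgroupOf H`: `h` belongs to it iff `x⁻¹ h x ∈ K`.
[cite: BernsteinZelevinsky1977, §2.3] -/
theorem mem_subgroupOf_map_conj_iff (x : G) (h : H) :
    h ∈ (K.map (MulAut.conj x).toMonoidHom).subgroupOf H ↔ x⁻¹ * (h : G) * x ∈ K := by
  rw [Subgroup.mem_subgroupOf, Subgroup.mem_map_equiv, MulAut.conj_symm_apply]

omit [TopologicalSpace G] [SeparatelyContinuousMul G] in
/-- At `x = 1` the subgroup `H ∩ x K x⁻¹` is `H ∩ K` (`K.subgroupOf H`), the subgroup of ★ `SmoothInductionSphericalLine`.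
[cite: BernsteinZelevinsky1977, §2.3] -/
theorem subgroupOf_map_conj_one : (K.map (MulAut.conj (1 : G)).toMonoidHom).subgroupOf H = K.subgroupOf H := by
  ext h
  rw [mem_subgroupOf_map_conj_iff, Subgroup.mem_subgroupOf, inv_one, one_mul, mul_one]

/-! ## §1 Values of `K`-fixed vectors at double-coset representatives -/

variable {H K} in
/-- **(M1) `f(x) ∈ W^{σ(H ∩ x K x⁻¹)}` for `f ∈ (Ind_H^G σ)^K`**: if `x⁻¹ h x ∈ K` then `σ h (f x) = f(h x) = f(x · x⁻¹ h x) = f(x)`.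
[cite: BernsteinZelevinsky1977, §2.3] [cite: CartierCorvallis1979, §III.3] -/
theorem toFun_mem_fixedPoints_subgroupOf_map_conj {f : SmoothInd H σ} (hf : f ∈ (smoothIndRep H σ).fixedPoints K) (x : G) :
    f.toFun x ∈ σ.fixedPoints ((K.map (MulAut.conj x).toMonoidHom).subgroupOf H) := by
  rw [mem_fixedPoints]
  intro h hh
  rw [mem_subgroupOf_map_conj_iff] at hh
  have e := (mem_fixedPoints_smoothIndRep_iff H K σ f).1 hf _ hh x
  have hx : x * (x⁻¹ * (h : G) * x) = h * x := by group
  rwa [hx, f.toFun_subgroup_mul] at e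

variable {H K} in
/-- **The value of a `K`-fixed vector on the double coset `H x K`**: `f(h x κ) = σ h (f x)` for `κ ∈ K`.
[cite: BernsteinZelevinsky1977, §2.3] [cite: CartierCorvallis1979, §III.3] -/
theorem toFun_eq_of_mem_fixedPoints_of_eq_mul {f : SmoothInd H σ} (hf : f ∈ (smoothIndRep H σ).fixedPoints K)
    {y x : G} {h : H} {κ : G} (hκ : κ ∈ K) (hy : y = h * x * κ) : f.toFun y = σ h (f.toFun x) := by
  rw [hy, mul_assoc, f.toFun_subgroup_mul, (mem_fixedPoints_smoothIndRep_iff H K σ f).1 hf κ hκ x]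

variable {H K} in
/-- **(M2) Injectivity of `f ↦ (f gᵢ)ᵢ` on `(Ind_H^G σ)^K`** when the double cosets `H gᵢ K` cover `G`: two `K`-fixed vectors with the
same values at every representative `gᵢ` are equal. [cite: BernsteinZelevinsky1977, §2.3] [cite: CartierCorvallis1979, §III.3] -/
theorem eq_of_forall_toFun_apply_eq {ι : Type*} {g : ι → G} (hcover : ∀ y : G, ∃ i, ∃ h : H, ∃ κ ∈ K, y = h * g i * κ)
    {f f' : SmoothInd H σ} (hf : f ∈ (smoothIndRep H σ).fixedPoints K) (hf' : f' ∈ (smoothIndRep H σ).fixedPoints K)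
    (he : ∀ i, f.toFun (g i) = f'.toFun (g i)) : f = f' := by
  refine SmoothInd.ext (funext fun y => ?_)
  obtain ⟨i, h, κ, hκ, hy⟩ := hcover y
  rw [toFun_eq_of_mem_fixedPoints_of_eq_mul σ hf hκ hy, toFun_eq_of_mem_fixedPoints_of_eq_mul σ hf' hκ hy, he i]

variable {H K} in
omit [TopologicalSpace G] [SeparatelyContinuousMul G] in
/-- **Well-definedness of `h x κ ↦ σ h w`** for `w ∈ W^{σ(H ∩ x K x⁻¹)}`: if `h x κ = h′ x κ′` then `x⁻¹ (h′⁻¹ h) x = κ′ κ⁻¹ ∈ K`, so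
`h′⁻¹ h` fixes `w`. [cite: BernsteinZelevinsky1977, §2.3] [cite: CartierCorvallis1979, §III.3] -/
theorem apply_eq_apply_of_mul_mul_eq {x : G} {w : W} (hw : w ∈ σ.fixedPoints ((K.map (MulAut.conj x).toMonoidHom).subgroupOf H))
    {h h' : H} {κ κ' : G} (hκ : κ ∈ K) (hκ' : κ' ∈ K) (he : (h : G) * x * κ = h' * x * κ') : σ h w = σ h' w := by
  have hmem : x⁻¹ * ((h'⁻¹ * h : H) : G) * x ∈ K := by
    have hx : x⁻¹ * ((h'⁻¹ * h : H) : G) * x = κ' * κ⁻¹ := by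
      rw [Subgroup.coe_mul, Subgroup.coe_inv]
      calc x⁻¹ * ((h' : G)⁻¹ * h) * x = x⁻¹ * (h' : G)⁻¹ * ((h : G) * x * κ) * κ⁻¹ := by group
        _ = x⁻¹ * (h' : G)⁻¹ * ((h' : G) * x * κ') * κ⁻¹ := by rw [he]
        _ = κ' * κ⁻¹ := by group
    rw [hx]
    exact K.mul_mem hκ' (K.inv_mem hκ)
  have hfix : σ (h'⁻¹ * h) w = w := (σ.mem_fixedPoints _ w).1 hw _ ((mem_subgroupOf_map_conj_iff H K x _).2 hmem)
  rw [map_mul, Module.End.mul_apply] at hfix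
  have := congrArg (σ h') hfix
  rwa [← Module.End.mul_apply, ← map_mul, mul_inv_cancel, map_one, Module.End.one_apply] at this

variable {H K} in
/-- **(M3) Surjectivity**: for `K` OPEN and double-coset representatives `gᵢ` (covering, pairwise inequivalent), every family
`wᵢ ∈ W^{σ(H ∩ gᵢ K gᵢ⁻¹)}` is the family of values at the `gᵢ` of a `K`-fixed vector `f` of `Ind_H^G σ`, namely `f(h gᵢ κ) = σ h wᵢ` —
`H`-equivariant by construction, right `K`-invariant, and smooth because the open subgroup `K` fixes it.
[cite: BernsteinZelevinsky1976, §2.21–2.25] [cite: BernsteinZelevinsky1977, §2.3] [cite: CartierCorvallis1979, §III.3] -/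
theorem exists_mem_fixedPoints_forall_toFun_eq {ι : Type*} {g : ι → G} (hKo : IsOpen (K : Set G))
    (hcover : ∀ y : G, ∃ i, ∃ h : H, ∃ κ ∈ K, y = h * g i * κ)
    (hdisj : ∀ i j, (∃ h : H, ∃ κ ∈ K, g j = h * g i * κ) → i = j)
    (w : ι → W) (hw : ∀ i, w i ∈ σ.fixedPoints ((K.map (MulAut.conj (g i)).toMonoidHom).subgroupOf H)) :
    ∃ f : SmoothInd H σ, f ∈ (smoothIndRep H σ).fixedPoints K ∧ (∀ i, f.toFun (g i) = w i) ∧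
      ∀ (i : ι) (h : H) (κ : G), κ ∈ K → f.toFun (h * g i * κ) = σ h (w i) := by
  classical
  choose ii hh κκ hκκ hdec using hcover
  -- the function and its value on every decomposition
  let F : G → W := fun y => σ (hh y) (w (ii y))
  have hF : ∀ (y : G) (i : ι) (h : H) (κ : G), κ ∈ K → y = h * g i * κ → F y = σ h (w i) := by
    intro y i h κ hκ hy
    have hij : ii y = i := by
      refine hdisj (ii y) i ⟨h⁻¹ * hh y, κκ y * κ⁻¹, K.mul_mem (hκκ y) (K.inv_mem hκ), ?_⟩
      rw [Subgroup.coe_mul, Subgroup.coe_inv]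
      calc g i = (h : G)⁻¹ * ((h : G) * g i * κ) * κ⁻¹ := by group
        _ = (h : G)⁻¹ * ((hh y : G) * g (ii y) * κκ y) * κ⁻¹ := by rw [← hy, ← hdec y]
        _ = (h : G)⁻¹ * hh y * g (ii y) * (κκ y * κ⁻¹) := by group
    have hdec' : (hh y : G) * g i * κκ y = h * g i * κ := by
      have e := hdec y
      rw [hij] at e
      exact e.symm.trans hy
    show σ (hh y) (w (ii y)) = σ h (w i)
    rw [hij]
    exact apply_eq_apply_of_mul_mul_eq σ (hw i) (hκκ y) hκ hdec'
  -- `H`-equivariance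
  have hFmem : F ∈ coindV H.subtype σ := by
    rw [mem_indFun_iff]
    intro h y
    rw [hF (h * y) (ii y) (h * hh y) (κκ y) (hκκ y) (by rw [Subgroup.coe_mul, mul_assoc, mul_assoc, ← mul_assoc (hh y : G), ← hdec y]),
      map_mul, Module.End.mul_apply]
  -- right `K`-invariance
  have hFK : ∀ κ ∈ K, ∀ y : G, F (y * κ) = F y := fun κ hκ y => by
    rw [hF (y * κ) (ii y) (hh y) (κκ y * κ) (K.mul_mem (hκκ y) hκ) (by rw [← mul_assoc, ← hdec y])]
  -- smoothness: the stabiliser contains the open `K`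
  have hFsm : (indFun H σ).IsSmoothVector (⟨F, hFmem⟩ : coindV H.subtype σ) := by
    refine (indFun H σ).isSmoothVector_of_le hKo fun κ hκ => ?_
    rw [mem_stabilizerSubgroup]
    exact Subtype.ext (funext fun y => hFK κ hκ y)
  let f : SmoothInd H σ := (⟨⟨F, hFmem⟩, hFsm⟩ : ↥(smoothInd H σ).toSubmodule)
  have hftoFun : f.toFun = F := rfl
  refine ⟨f, (mem_fixedPoints_smoothIndRep_iff H K σ f).2 fun κ hκ y => by rw [hftoFun, hFK κ hκ y], fun i => ?_, fun i h κ hκ => ?_⟩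
  · rw [hftoFun, hF (g i) i 1 1 K.one_mem (by rw [Subgroup.coe_one, one_mul, mul_one]), map_one, Module.End.one_apply]
  · rw [hftoFun]
    exact hF _ i h κ hκ rfl

/-! ## §2 `(Ind_H^G σ)^K ≃ Πᵢ W^{σ(H ∩ gᵢ K gᵢ⁻¹)}` and dimension counts -/

variable {H K} in
/-- **(M4) MACKEY FOR FIXED VECTORS: `(Ind_H^G σ)^K ≃ₗ Πᵢ W^{σ(H ∩ gᵢ K gᵢ⁻¹)}` by `f ↦ (f gᵢ)ᵢ`** (`K` open, `G = ⨆ᵢ H gᵢ K` a double-coset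
decomposition).  The one-coset case `g = 1`, `G = H · K` is ★ `nonempty_fixedPoints_linearEquiv`.
[cite: BernsteinZelevinsky1977, §2.3] [cite: CartierCorvallis1979, §III.3] -/
theorem nonempty_fixedPoints_linearEquiv_pi {ι : Type*} {g : ι → G} (hKo : IsOpen (K : Set G))
    (hcover : ∀ y : G, ∃ i, ∃ h : H, ∃ κ ∈ K, y = h * g i * κ)
    (hdisj : ∀ i j, (∃ h : H, ∃ κ ∈ K, g j = h * g i * κ) → i = j) :
    ∃ e : ↥((smoothIndRep H σ).fixedPoints K) ≃ₗ[k] (Π i, ↥(σ.fixedPoints ((K.map (MulAut.conj (g i)).toMonoidHom).subgroupOf H))),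
      ∀ (f : ↥((smoothIndRep H σ).fixedPoints K)) (i : ι), (e f i : W) = (f : SmoothInd H σ).toFun (g i) := by
  classical
  let ev : ↥((smoothIndRep H σ).fixedPoints K) →ₗ[k] (Π i, ↥(σ.fixedPoints ((K.map (MulAut.conj (g i)).toMonoidHom).subgroupOf H))) :=
    { toFun := fun f i => ⟨(f : SmoothInd H σ).toFun (g i), toFun_mem_fixedPoints_subgroupOf_map_conj σ f.2 (g i)⟩
      map_add' := fun f f' => funext fun i => Subtype.ext rfl
      map_smul' := fun c f => funext fun i => Subtype.ext rfl }
  have hinj : Function.Injective ev := fun f f' hff' =>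
    Subtype.ext (eq_of_forall_toFun_apply_eq σ hcover f.2 f'.2 fun i => congrArg (fun v => ((v i : _) : W)) hff')
  have hsurj : Function.Surjective ev := fun v => by
    obtain ⟨f, hf, hfi, -⟩ := exists_mem_fixedPoints_forall_toFun_eq σ hKo hcover hdisj (fun i => (v i : W)) (fun i => (v i).2)
    exact ⟨⟨f, hf⟩, funext fun i => Subtype.ext (hfi i)⟩
  exact ⟨LinearEquiv.ofBijective ev ⟨hinj, hsurj⟩, fun f i => rfl⟩

/-- **`dim (Ind_H^G σ)^K ≤ Σᵢ dim W^{σ(H ∩ gᵢ K gᵢ⁻¹)}`** from the covering alone (no disjointness; `k` a field, `W` finite-dimensional,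
`ι` finite): the evaluation map `f ↦ (f gᵢ)ᵢ` is injective. [cite: BernsteinZelevinsky1977, §2.3] [cite: CartierCorvallis1979, §III.3] -/
theorem finrank_fixedPoints_smoothIndRep_le_sum {k : Type*} [Field k] {W : Type*} [AddCommGroup W] [Module k W] [FiniteDimensional k W]
    {H K : Subgroup G} (σ : Representation k H W) {ι : Type*} [Fintype ι] {g : ι → G}
    (hcover : ∀ y : G, ∃ i, ∃ h : H, ∃ κ ∈ K, y = h * g i * κ) :
    Module.finrank k ((smoothIndRep H σ).fixedPoints K) ≤
      ∑ i, Module.finrank k (σ.fixedPoints ((K.map (MulAut.conj (g i)).toMonoidHom).subgroupOf H)) := by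
  classical
  let ev : ↥((smoothIndRep H σ).fixedPoints K) →ₗ[k] (Π i, ↥(σ.fixedPoints ((K.map (MulAut.conj (g i)).toMonoidHom).subgroupOf H))) :=
    { toFun := fun f i => ⟨(f : SmoothInd H σ).toFun (g i), toFun_mem_fixedPoints_subgroupOf_map_conj σ f.2 (g i)⟩
      map_add' := fun f f' => funext fun i => Subtype.ext rfl
      map_smul' := fun c f => funext fun i => Subtype.ext rfl }
  have hinj : Function.Injective ev := fun f f' hff' =>
    Subtype.ext (eq_of_forall_toFun_apply_eq σ hcover f.2 f'.2 fun i => congrArg (fun v => ((v i : _) : W)) hff')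
  rw [← Module.finrank_pi_fintype k]
  exact LinearMap.finrank_le_finrank_of_injective hinj

/-- **`dim (Ind_H^G σ)^K = Σᵢ dim W^{σ(H ∩ gᵢ K gᵢ⁻¹)}`** (`k` a field, `W` finite-dimensional, `ι` finite, `K` open, `G = ⨆ᵢ H gᵢ K`).
[cite: BernsteinZelevinsky1977, §2.3] [cite: CartierCorvallis1979, §III.3] -/
theorem finrank_fixedPoints_smoothIndRep_eq_sum {k : Type*} [Field k] {W : Type*} [AddCommGroup W] [Module k W] [FiniteDimensional k W]
    {H K : Subgroup G} (σ : Representation k H W) {ι : Type*} [Fintype ι] {g : ι → G} (hKo : IsOpen (K : Set G))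
    (hcover : ∀ y : G, ∃ i, ∃ h : H, ∃ κ ∈ K, y = h * g i * κ)
    (hdisj : ∀ i j, (∃ h : H, ∃ κ ∈ K, g j = h * g i * κ) → i = j) :
    Module.finrank k ((smoothIndRep H σ).fixedPoints K) =
      ∑ i, Module.finrank k (σ.fixedPoints ((K.map (MulAut.conj (g i)).toMonoidHom).subgroupOf H)) := by
  obtain ⟨e, -⟩ := nonempty_fixedPoints_linearEquiv_pi σ hKo hcover hdisj
  rw [e.finrank_eq, Module.finrank_pi_fintype]

omit [TopologicalSpace G] [SeparatelyContinuousMul G] in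
/-- **Fixed vectors of a character**: on a LINE `W`, the subspace `W^{σ(S)}` fixed by a subgroup `S ≤ H` has dimension `1` if `σ` is
trivial on `S` and `0` otherwise. [cite: CartierCorvallis1979, §IV.1] -/
theorem finrank_fixedPoints_line_eq_ite {k : Type*} [Field k] {W : Type*} [AddCommGroup W] [Module k W] {H : Subgroup G}
    (σ : Representation k H W) (hW : Module.finrank k W = 1) (S : Subgroup H) [Decidable (∀ h ∈ S, σ h = 1)] :
    Module.finrank k (σ.fixedPoints S) = if (∀ h ∈ S, σ h = 1) then 1 else 0 := by
  haveI : FiniteDimensional k W := .of_finrank_eq_succ hW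
  split_ifs with hS
  · have htop : σ.fixedPoints S = ⊤ := by
      refine eq_top_iff.2 fun w _ => (σ.mem_fixedPoints _ w).2 fun h hh => ?_
      rw [hS h hh, Module.End.one_apply]
    rw [htop, finrank_top, hW]
  · -- `W^{σ(S)} ≠ ⊤` (some `σ h ≠ 1`, and on a line `σ h w₀ = w₀` for a generator forces `σ h = 1`), so its dimension is `< 1`
    have hne : σ.fixedPoints S ≠ ⊤ := by
      intro htop
      apply hS
      intro h hh
      refine LinearMap.ext fun w => ?_
      have hw : w ∈ σ.fixedPoints S := htop ▸ Submodule.mem_top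
      rw [Module.End.one_apply]
      exact (σ.mem_fixedPoints S w).1 hw h hh
    have hle : Module.finrank k (σ.fixedPoints S) ≤ 1 := hW ▸ Submodule.finrank_le _
    have hne1 : Module.finrank k (σ.fixedPoints S) ≠ 1 := fun h1 => hne (Submodule.eq_top_of_finrank_eq (h1.trans hW.symm))
    omega

/-- **MACKEY'S COUNT for a character: `dim (Ind_H^G σ)^K = #{i | σ is trivial on H ∩ gᵢ K gᵢ⁻¹}`** (`W` a line, `k` a field, `ι` finite,
`K` open, `G = ⨆ᵢ H gᵢ K`). [cite: BernsteinZelevinsky1977, §2.3] [cite: CartierCorvallis1979, §III.3] [cite: Casselman1995, §3] -/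
theorem finrank_fixedPoints_smoothIndRep_eq_card_filter {k : Type*} [Field k] {W : Type*} [AddCommGroup W] [Module k W]
    {H K : Subgroup G} (σ : Representation k H W) {ι : Type*} [Fintype ι] {g : ι → G} (hKo : IsOpen (K : Set G))
    (hcover : ∀ y : G, ∃ i, ∃ h : H, ∃ κ ∈ K, y = h * g i * κ)
    (hdisj : ∀ i j, (∃ h : H, ∃ κ ∈ K, g j = h * g i * κ) → i = j) (hW : Module.finrank k W = 1)
    [DecidablePred fun i => ∀ h : H, (g i)⁻¹ * (h : G) * g i ∈ K → σ h = 1] :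
    Module.finrank k ((smoothIndRep H σ).fixedPoints K) =
      (Finset.univ.filter fun i => ∀ h : H, (g i)⁻¹ * (h : G) * g i ∈ K → σ h = 1).card := by
  classical
  haveI : FiniteDimensional k W := .of_finrank_eq_succ hW
  rw [finrank_fixedPoints_smoothIndRep_eq_sum σ hKo hcover hdisj, Finset.card_filter]
  refine Finset.sum_congr rfl fun i _ => ?_
  rw [finrank_fixedPoints_line_eq_ite σ hW]
  have hiff : (∀ h ∈ (K.map (MulAut.conj (g i)).toMonoidHom).subgroupOf H, σ h = 1) ↔
      ∀ h : H, (g i)⁻¹ * (h : G) * g i ∈ K → σ h = 1 :=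
    forall_congr' fun h => by rw [mem_subgroupOf_map_conj_iff]
  simp only [hiff]

/-- **`dim (Ind_H^G σ)^K = |ι|` for a character trivial on every `H ∩ gᵢ K gᵢ⁻¹`** (`W` a line; e.g. an UNRAMIFIED `χ` of a Borel `B = TU`
along a Bruhat–Iwahori decomposition `G = ⨆_{w ∈ W} B w I`: `dim (i_B χ)^I = |W|`; the one-coset case `G = H·K` is the spherical LINE of ★
`finrank_fixedPoints_smoothIndRep_eq_one`). [cite: CartierCorvallis1979, §III.3–§IV.1] [cite: Casselman1995, §3] [cite: Borel1976, §3–§4] -/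
theorem finrank_fixedPoints_smoothIndRep_eq_card {k : Type*} [Field k] {W : Type*} [AddCommGroup W] [Module k W]
    {H K : Subgroup G} (σ : Representation k H W) {ι : Type*} [Fintype ι] {g : ι → G} (hKo : IsOpen (K : Set G))
    (hcover : ∀ y : G, ∃ i, ∃ h : H, ∃ κ ∈ K, y = h * g i * κ)
    (hdisj : ∀ i j, (∃ h : H, ∃ κ ∈ K, g j = h * g i * κ) → i = j) (hW : Module.finrank k W = 1)
    (hσ : ∀ (i : ι) (h : H), (g i)⁻¹ * (h : G) * g i ∈ K → σ h = 1) :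
    Module.finrank k ((smoothIndRep H σ).fixedPoints K) = Fintype.card ι := by
  classical
  rw [finrank_fixedPoints_smoothIndRep_eq_card_filter σ hKo hcover hdisj hW, Finset.filter_true_of_mem fun i _ => hσ i,
    Finset.card_univ]

/-! ## §3 Indexing by the double-coset space `H\G/K` (Mathlib `DoubleCoset.Quotient`) -/

omit [TopologicalSpace G] [SeparatelyContinuousMul G] in
/-- The representatives `q.out`, `q ∈ H\G/K`, COVER: every `y` is `h · (H y K).out · κ`. [cite: BernsteinZelevinsky1977, §2.3] -/
theorem exists_eq_mul_out_mul (y : G) :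
    ∃ h : H, ∃ κ ∈ K, y = h * (DoubleCoset.mk H K y : DoubleCoset.Quotient (H : Set G) K).out * κ := by
  obtain ⟨h, κ, hh, hκ, he⟩ := DoubleCoset.mk_out_eq_mul H K y
  refine ⟨⟨h⁻¹, H.inv_mem hh⟩, κ⁻¹, K.inv_mem hκ, ?_⟩
  rw [he]
  group

omit [TopologicalSpace G] [SeparatelyContinuousMul G] in
/-- The representatives `q.out`, `q ∈ H\G/K`, are PAIRWISE INEQUIVALENT: `q′.out ∈ H q.out K ⇒ q = q′`. [cite: BernsteinZelevinsky1977, §2.3] -/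
theorem eq_of_out_eq_mul_out_mul (q q' : DoubleCoset.Quotient (H : Set G) K)
    (hqq' : ∃ h : H, ∃ κ ∈ K, q'.out = h * q.out * κ) : q = q' := by
  obtain ⟨h, κ, hκ, he⟩ := hqq'
  rw [← DoubleCoset.out_eq' H K q, ← DoubleCoset.out_eq' H K q', DoubleCoset.eq]
  exact ⟨h, h.2, κ, hκ, he⟩

omit [TopologicalSpace G] [SeparatelyContinuousMul G] in
/-- DICTIONARY (cover): if `i ↦ H gᵢ K` is SURJECTIVE onto `H\G/K`, the double cosets `H gᵢ K` cover `G`. [cite: BernsteinZelevinsky1977, §2.3] -/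
theorem exists_eq_mul_mul_of_surjective_mk {ι : Type*} {g : ι → G}
    (hg : Function.Surjective fun i => (DoubleCoset.mk H K (g i) : DoubleCoset.Quotient (H : Set G) K)) (y : G) :
    ∃ i, ∃ h : H, ∃ κ ∈ K, y = h * g i * κ := by
  obtain ⟨i, hi⟩ := hg (DoubleCoset.mk H K y)
  obtain ⟨h, hh, κ, hκ, he⟩ := (DoubleCoset.eq H K (g i) y).1 hi
  exact ⟨i, ⟨h, hh⟩, κ, hκ, he⟩

omit [TopologicalSpace G] [SeparatelyContinuousMul G] in
/-- DICTIONARY (disjointness): if `i ↦ H gᵢ K` is INJECTIVE, distinct indices give inequivalent representatives. [cite: BernsteinZelevinsky1977, §2.3] -/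
theorem eq_of_injective_mk {ι : Type*} {g : ι → G}
    (hg : Function.Injective fun i => (DoubleCoset.mk H K (g i) : DoubleCoset.Quotient (H : Set G) K)) (i j : ι)
    (hij : ∃ h : H, ∃ κ ∈ K, g j = h * g i * κ) : i = j := by
  obtain ⟨h, κ, hκ, he⟩ := hij
  exact hg ((DoubleCoset.eq H K (g i) (g j)).2 ⟨h, h.2, κ, hκ, he⟩)

variable {H K} in
/-- **`(Ind_H^G σ)^K ≃ₗ Π_{q ∈ H\G/K} W^{σ(H ∩ q.out K q.out⁻¹)}`** — (M4) along the canonical section `q ↦ q.out` of Mathlib's double-coset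
space (`K` open; no further hypothesis). [cite: BernsteinZelevinsky1977, §2.3] [cite: CartierCorvallis1979, §III.3] -/
theorem nonempty_fixedPoints_linearEquiv_pi_doubleCoset (hKo : IsOpen (K : Set G)) :
    ∃ e : ↥((smoothIndRep H σ).fixedPoints K) ≃ₗ[k]
        (Π q : DoubleCoset.Quotient (H : Set G) K, ↥(σ.fixedPoints ((K.map (MulAut.conj q.out).toMonoidHom).subgroupOf H))),
      ∀ (f : ↥((smoothIndRep H σ).fixedPoints K)) (q : DoubleCoset.Quotient (H : Set G) K),
        (e f q : W) = (f : SmoothInd H σ).toFun q.out :=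
  nonempty_fixedPoints_linearEquiv_pi σ (g := fun q : DoubleCoset.Quotient (H : Set G) K => q.out) hKo
    (fun y => ⟨DoubleCoset.mk H K y, exists_eq_mul_out_mul H K y⟩) (eq_of_out_eq_mul_out_mul H K)

/-- **`dim (Ind_H^G σ)^K = Σ_{q ∈ H\G/K} dim W^{σ(H ∩ q.out K q.out⁻¹)}`** when the double-coset space is finite (`k` a field, `W`
finite-dimensional, `K` open). [cite: BernsteinZelevinsky1977, §2.3] [cite: CartierCorvallis1979, §III.3] -/
theorem finrank_fixedPoints_smoothIndRep_eq_sum_doubleCoset {k : Type*} [Field k] {W : Type*} [AddCommGroup W] [Module k W]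
    [FiniteDimensional k W] {H K : Subgroup G} (σ : Representation k H W) [Fintype (DoubleCoset.Quotient (H : Set G) K)]
    (hKo : IsOpen (K : Set G)) :
    Module.finrank k ((smoothIndRep H σ).fixedPoints K) =
      ∑ q : DoubleCoset.Quotient (H : Set G) K, Module.finrank k (σ.fixedPoints ((K.map (MulAut.conj q.out).toMonoidHom).subgroupOf H)) :=
  finrank_fixedPoints_smoothIndRep_eq_sum σ hKo (fun y => ⟨DoubleCoset.mk H K y, exists_eq_mul_out_mul H K y⟩)
    (eq_of_out_eq_mul_out_mul H K)

end Representation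

end
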